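import Summits.ResolutionOfSingularities.ResolutionOfSingularities.Theorems.PurelyInseparableDim4ParamLiftSources
import HarnessLib

/-!
# [OURS · res-dim4-pi · F4-C-loc] PARAMETRIC LIFT KIT, part 3: TWO-LETTER REPLIES — the monomial shear
  `xᵢ ↦ xᵢ + ρ·t^d` (a fibre coordinate tied to the letter), the PAIR check (`bᵢ = f ρ · b_{i'}^d` from a linear
  two-source constraint) and the RELATION check (a binomial two-source constraint whose non-degenerate branch is killed
  by a second exponent)

Cell `res-dim4-pi` (D-0157 DOOR 2, wave 2), seat `res-dim4-p-6` g3; sequel of `…ParamLift` / `…ParamLiftSources`.  The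
seat's symbolic census of the LOCAL in-scope game at `(3,3)` on 2-monomial roots (WORD #92 (d)) meets, beyond witness /
forcing / rational root / free letter, two more shapes of B's reply locus in a chart; this file makes them `decide`-able:

* §5 `shearMonoAlg i ρ d` (`xᵢ ↦ xᵢ + ρ·t^d`), `shearMonoL`, `shearMonoAlg_evalT`, and **`translate_pair_spec`**:
  translating by the point `β'·δ_{i'} + (f ρ·β'^d)·δᵢ` is, on the data, `shearAlg i'` followed by `shearMonoAlg i ρ d`,
  read at the letter value `β'`.
* §6 **`ppairB` ⇒ `coord_eq_of_ppairB`**: the sources of a low `γ` are two single terms, one moving only in `xᵢ` and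
  LINEARLY, the other only in `x_{i'}` to the power `d ≥ 1` (same power of the letter): an equimultiple point has
  `bᵢ = f ρ · b_{i'}^d` (`ρ ∈ k` computed by the checker).
* (sequel `…ParamLiftRel`: the RELATION check `prelB` — a binomial two-source constraint whose non-degenerate branch
  is killed by a second exponent.)  The pair check accepts the two sources in either list order.

Every non-vanishing claim is still about single terms and rational constants (`β ≠ 0`, `f` injective); no relation
among letters is carried forward.  [OURS · counted 0 · instrument; AI kernel work, weaker than expert review.]  NOTHING
here is a statement about resolution of singularities; resolution in dimension `≥ 4` / characteristic `p > 0` is NOT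
proved by anything in this file.  bears_on: LADDER-RESOLUTION:D157-DOOR2 (res-dim4-pi · F4-C-loc all fields · parametric
rows).  Host item (DR-157-C): `stmt-ResolutionOfSingularities-16155`, helper.
-/

set_option linter.dupNamespace false -- mandated namespace of this single-conjunct summit

noncomputable section

open MvPolynomial Finset
open scoped BigOperators

namespace Summit.ResolutionOfSingularities.ResolutionOfSingularities.Theorems.PIDim4

namespace ParamLift

open Literature.AlgebraicGeometry.Resolution
open Literature.AlgebraicGeometry.Resolution.CentreBlowup
open StepKit

variable {k K : Type} [Field k] [Field K] [DecidableEq k] [DecidableEq K] (f : k →+* K) (β : K)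

/-! ## §5 The monomial shear `xᵢ ↦ xᵢ + ρ·t^d` -/

/-- the substitution `xᵢ ↦ xᵢ + ρ·t^d`. OURS. [folklore] -/
def shearMonoAlg (i : Fin 4) (ρ : k) (d : ℕ) : MvPolynomial (Fin 5) k →ₐ[k] MvPolynomial (Fin 5) k :=
  aeval (Function.update X i.castSucc (X i.castSucc + C ρ * X (Fin.last 4) ^ d))

omit [DecidableEq k] in
/-- `shearMonoAlg` fixes constants. OURS. [folklore] -/
theorem shearMonoAlg_C (i : Fin 4) (ρ : k) (d : ℕ) (c : k) :
    shearMonoAlg i ρ d (C c) = (C c : MvPolynomial (Fin 5) k) := by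
  rw [shearMonoAlg, aeval_C, algebraMap_eq]

omit [DecidableEq k] in
/-- `shearMonoAlg` on a letter. OURS. [folklore] -/
theorem shearMonoAlg_X (i : Fin 4) (ρ : k) (d : ℕ) (m : Fin 5) :
    shearMonoAlg i ρ d (X m) =
      if m = i.castSucc then X i.castSucc + C ρ * X (Fin.last 4) ^ d else (X m : MvPolynomial (Fin 5) k) := by
  rw [shearMonoAlg, aeval_X, Function.update_apply]

/-- `shearMonoAlg` on term lists: `xᵢ^e ↦ Σ_l C(e,l) ρ^{e−l} xᵢ^l t^{d(e−l)}`. OURS. [folklore] -/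
def shearMonoL (i : Fin 4) (ρ : k) (d : ℕ) (L : Terms 5 k) : Terms 5 k :=
  L.flatMap fun t => (List.range (t.1 i.castSucc + 1)).map fun l =>
    (Function.update (Function.update t.1 i.castSucc l) (Fin.last 4) (t.1 (Fin.last 4) + d * (t.1 i.castSucc - l)),
      t.2 * (((t.1 i.castSucc).choose l : k) * ρ ^ (t.1 i.castSucc - l)))

omit [DecidableEq k] in
/-- **`shearMonoAlg` on a monomial** is the binomial expansion. OURS. [folklore] -/
theorem shearMonoAlg_monomial (i : Fin 4) (ρ : k) (d : ℕ) (e : Fin 5 → ℕ) (c : k) :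
    shearMonoAlg i ρ d (monomial (expo e) c) = evalT ((List.range (e i.castSucc + 1)).map fun l =>
      (Function.update (Function.update e i.castSucc l) (Fin.last 4) (e (Fin.last 4) + d * (e i.castSucc - l)),
        c * (((e i.castSucc).choose l : k) * ρ ^ (e i.castSucc - l)))) := by
  have hne : (Fin.last 4 : Fin 5) ≠ i.castSucc := (Fin.castSucc_lt_last i).ne'
  rw [evalT_eq_sum, List.map_map, list_sum_range_map, monomial_expo_eq, prod_pow_eq_mul _ i.castSucc, map_mul,
    shearMonoAlg_C, map_mul, map_pow, shearMonoAlg_X, if_pos rfl, map_prod,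
    ← Finset.mul_prod_erase (univ.erase i.castSucc) _ (Finset.mem_erase.mpr ⟨hne, mem_univ _⟩)]
  have hfix : (∏ m ∈ (univ.erase i.castSucc).erase (Fin.last 4),
      shearMonoAlg i ρ d ((X m : MvPolynomial (Fin 5) k) ^ e m)) =
      ∏ m ∈ (univ.erase i.castSucc).erase (Fin.last 4), (X m : MvPolynomial (Fin 5) k) ^ e m :=
    Finset.prod_congr rfl fun m hm => by
      rw [map_pow, shearMonoAlg_X, if_neg (ne_of_mem_erase (mem_of_mem_erase hm))]
  rw [hfix, map_pow, shearMonoAlg_X, if_neg hne, add_pow, Finset.sum_mul, Finset.mul_sum]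
  refine Finset.sum_congr rfl fun l _ => ?_
  simp only [Function.comp_apply]
  rw [monomial_update_update_eq, map_mul, map_mul, map_natCast, map_pow, pow_add, mul_pow, ← pow_mul, ← C_pow]
  ring

omit [DecidableEq k] in
/-- **`shearMonoAlg` on a presented polynomial is `shearMonoL`.** OURS. [folklore] -/
theorem shearMonoAlg_evalT (i : Fin 4) (ρ : k) (d : ℕ) (L : Terms 5 k) :
    shearMonoAlg i ρ d (evalT L) = evalT (shearMonoL i ρ d L) := by
  induction L with
  | nil => simp [shearMonoL]
  | cons t L ih =>
    simp only [shearMonoL, List.flatMap_cons] at ih ⊢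
    rw [evalT_cons, map_add, ih, shearMonoAlg_monomial, evalT_append]

omit [DecidableEq k] [DecidableEq K] in
/-- **translation by a PAIR point**: moving `x_{i'}` by the letter `β` and `xᵢ` by `f ρ·β^d` is, on the data,
`shearAlg i'` then `shearMonoAlg i ρ d`, read at `β`. OURS. [folklore] -/
theorem translate_pair_spec {i i' : Fin 4} (hii' : i ≠ i') (ρ : k) (d : ℕ) (P : MvPolynomial (Fin 5) k) :
    PointBlowup.translate (Pi.single i' β + Pi.single i (f ρ * β ^ d)) (spec f β P) =
      spec f β (shearMonoAlg i ρ d (shearAlg i' P)) := by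
  have h1 : (aeval fun m : Fin 4 =>
      (X m + C ((Pi.single i' β + Pi.single i (f ρ * β ^ d) : Fin 4 → K) m) : MvPolynomial (Fin 4) K)).toRingHom.comp
      (spec f β) = (spec f β).comp ((shearMonoAlg i ρ d (k := k)).toRingHom.comp (shearAlg i' (k := k)).toRingHom) := by
    refine MvPolynomial.ringHom_ext (fun c => ?_) (fun m => ?_)
    · simp [spec, shearAlg, shearMonoAlg]
    · rw [RingHom.comp_apply, RingHom.comp_apply, RingHom.comp_apply]
      show aeval _ (spec f β (X m)) = spec f β (shearMonoAlg i ρ d (shearAlg i' (X m)))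
      rw [shearAlg_X]
      induction m using Fin.lastCases with
      | last =>
        rw [spec_X_last, aeval_C, algebraMap_eq, if_neg (Fin.castSucc_lt_last i').ne', shearMonoAlg_X,
          if_neg (Fin.castSucc_lt_last i).ne', spec_X_last]
      | cast m =>
        rw [spec_X_castSucc, aeval_X, Pi.add_apply]
        by_cases hm : m = i'
        · subst hm
          rw [if_pos rfl, Pi.single_eq_same, Pi.single_eq_of_ne (Ne.symm hii'), add_zero, map_add (shearMonoAlg i ρ d),
            shearMonoAlg_X, if_neg (fun h => hii' (Fin.castSucc_injective _ h).symm), shearMonoAlg_X,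
            if_neg (Fin.castSucc_lt_last i).ne', map_add (spec f β), spec_X_castSucc, spec_X_last]
        · rw [if_neg (fun h => hm (Fin.castSucc_injective _ h)), shearMonoAlg_X, Pi.single_eq_of_ne hm, zero_add]
          by_cases hmi : m = i
          · subst hmi
            rw [if_pos rfl, map_add, map_mul, map_pow, spec_X_castSucc, spec_C, spec_X_last, Pi.single_eq_same,
              ← C_pow, ← map_mul]
          · rw [if_neg (fun h => hmi (Fin.castSucc_injective _ h)), spec_X_castSucc, Pi.single_eq_of_ne hmi, C_0,
              add_zero]
  exact congrArg (fun φ : MvPolynomial (Fin 5) k →+* MvPolynomial (Fin 4) K => φ P) h1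

/-! ## §6 The PAIR check: a linear two-source constraint ties one fibre coordinate to another -/

/-- the moving coordinates of a source term (where its x-part exceeds `γ`). OURS. [folklore] -/
def moves (γ : Fin 4 → ℕ) (e : Fin 5 → ℕ) : Finset (Fin 4) := Finset.univ.filter fun m => γ m < e m.castSucc

/-- the binomial product `∏ C(e_m, γ_m)` of a source term, in `k`. OURS. [folklore] -/
def binomK (γ : Fin 4 → ℕ) (e : Fin 5 → ℕ) : k := ∏ m : Fin 4, (((e m.castSucc).choose (γ m) : ℕ) : k)

omit [DecidableEq k] [DecidableEq K] in
/-- the Taylor term factors as coefficient × letter power × binomial product × `∏ b_m^{e_m − γ_m}`. OURS. [folklore] -/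
theorem pterm_eq (γ : Fin 4 → ℕ) (b : Fin 4 → K) (t : (Fin 5 → ℕ) × k) :
    pterm f β γ b t = f t.2 * β ^ t.1 (Fin.last 4) * f (binomK γ t.1) *
      ∏ m : Fin 4, b m ^ (t.1 m.castSucc - γ m) := by
  unfold pterm binomK
  rw [map_prod, Finset.prod_mul_distrib]
  simp only [map_natCast]
  ring

/-- core of the pair check for an ORDERED pair (`t₁` linear in `xᵢ`, `t₂` of degree `d` in `x_{i'}`). OURS. [folklore] -/
def pairCoreB (γ : Fin 4 → ℕ) (i i' : Fin 4) (ρ : k) (d : ℕ) (t₁ t₂ : (Fin 5 → ℕ) × k) : Bool :=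
  decide (moves γ t₁.1 = {i}) && decide (t₁.1 i.castSucc = γ i + 1) && decide (moves γ t₂.1 = {i'}) &&
    decide (t₂.1 i'.castSucc = γ i' + d) && decide (1 ≤ d) && decide (t₁.1 (Fin.last 4) = t₂.1 (Fin.last 4)) &&
    !decide (t₁.2 * binomK γ t₁.1 = 0) && !decide (binomK γ t₂.1 = (0 : k)) && !decide (t₂.2 = 0) &&
    decide (ρ * (t₁.2 * binomK γ t₁.1) = -(t₂.2 * binomK γ t₂.1))

/-- **pair check**: `γ` low, `i ≠ i'` both free, and the sources of `γ` are an ordered pair as in `pairCoreB` (either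
list order). OURS. [folklore] -/
def ppairB (q : ℕ) (U : Finset (Fin 4)) (G : Terms 5 k) (γ : Fin 4 → ℕ) (i i' : Fin 4) (ρ : k) (d : ℕ) : Bool :=
  !decide (γ = 0) && decide (∑ m, γ m < q) && decide (i ∈ U) && decide (i' ∈ U) && !decide (i = i') &&
    match srcTerms U γ G with
    | [t₁, t₂] => pairCoreB γ i i' ρ d t₁ t₂ || pairCoreB γ i i' ρ d t₂ t₁
    | _ => false

omit [Field K] [DecidableEq K] in
/-- the low-exponent data of a pair check. OURS. [folklore] -/
theorem ppairB_low {q : ℕ} {U : Finset (Fin 4)} {G : Terms 5 k} {γ : Fin 4 → ℕ} {i i' : Fin 4} {ρ : k} {d : ℕ}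
    (h : ppairB q U G γ i i' ρ d = true) : γ ≠ 0 ∧ ∑ m, γ m < q := by
  unfold ppairB at h
  simp only [Bool.and_eq_true, Bool.not_eq_true', decide_eq_false_iff_not, decide_eq_true_eq] at h
  exact ⟨h.1.1.1.1.1, h.1.1.1.1.2⟩

omit [DecidableEq k] [DecidableEq K] in
/-- a source moving only in `j` to exponent `γ j + d`: its `b`-product is `b_j^d`. OURS. [folklore] -/
theorem prod_pow_of_moves {γ : Fin 4 → ℕ} {e : Fin 5 → ℕ} {j : Fin 4} {d : ℕ} (hmv : moves γ e = {j})
    (hj : e j.castSucc = γ j + d) (b : Fin 4 → K) :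
    (∏ m : Fin 4, b m ^ (e m.castSucc - γ m)) = b j ^ d := by
  rw [← Finset.mul_prod_erase univ _ (mem_univ j), hj, Nat.add_sub_cancel_left]
  have : (∏ m ∈ univ.erase j, b m ^ (e m.castSucc - γ m)) = 1 :=
    Finset.prod_eq_one fun m hm => by
      have hmm : m ∉ moves γ e := by rw [hmv, Finset.mem_singleton]; exact ne_of_mem_erase hm
      simp only [moves, Finset.mem_filter, Finset.mem_univ, true_and, not_lt] at hmm
      rw [Nat.sub_eq_zero_of_le hmm, pow_zero]
  rw [this, mul_one]

omit [DecidableEq K] in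
/-- ordered pair ⇒ the tie. OURS. [folklore] -/
theorem coord_eq_of_pairCoreB {γ : Fin 4 → ℕ} {i i' : Fin 4} {ρ : k} {d : ℕ} {t₁ t₂ : (Fin 5 → ℕ) × k}
    (hβ : β ≠ 0) (h : pairCoreB γ i i' ρ d t₁ t₂ = true) {b : Fin 4 → K}
    (hzero : pterm f β γ b t₁ + pterm f β γ b t₂ = 0) : b i = f ρ * b i' ^ d := by
  simp only [pairCoreB, Bool.and_eq_true, decide_eq_true_eq, Bool.not_eq_true', decide_eq_false_iff_not] at h
  obtain ⟨⟨⟨⟨⟨⟨⟨⟨⟨hm1, he1⟩, hm2⟩, he2⟩, -⟩, ht⟩, hA⟩, -⟩, -⟩, hρ⟩ := h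
  rw [pterm_eq, pterm_eq, prod_pow_of_moves hm1 he1, prod_pow_of_moves hm2 he2, pow_one, ht] at hzero
  have hAK : f (t₁.2 * binomK γ t₁.1) ≠ 0 := (map_ne_zero_iff f f.injective).mpr hA
  have hβa : β ^ t₂.1 (Fin.last 4) ≠ 0 := pow_ne_zero _ hβ
  apply mul_left_cancel₀ (mul_ne_zero hAK hβa)
  rw [map_mul] at hAK ⊢
  have hρ' : f ρ * (f t₁.2 * f (binomK γ t₁.1)) = -(f t₂.2 * f (binomK γ t₂.1)) := by
    rw [← map_mul, ← map_mul, ← map_mul, hρ, map_neg, map_mul]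
  linear_combination hzero - β ^ t₂.1 (Fin.last 4) * b i' ^ d * hρ'

omit [DecidableEq K] in
/-- **a pair check ties the letter**: if the coefficient of `x^γ` vanishes at `b` (vanishing off `U`) then
`bᵢ = f ρ · b_{i'}^d`. OURS. [folklore] -/
theorem coord_eq_of_ppairB {q : ℕ} {U : Finset (Fin 4)} {G : Terms 5 k} {γ : Fin 4 → ℕ} {i i' : Fin 4} {ρ : k}
    {d : ℕ} (hβ : β ≠ 0) (h : ppairB q U G γ i i' ρ d = true) {b : Fin 4 → K}
    (hb : ∀ m : Fin 4, m ∉ U → b m = 0)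
    (hzero : coeff (expo γ) (PointBlowup.translate b (spec f β (evalT G))) = 0) : b i = f ρ * b i' ^ d := by
  unfold ppairB at h
  simp only [Bool.and_eq_true] at h
  obtain ⟨-, hm⟩ := h
  rw [coeff_translate_spec_evalT, sum_pterm_filter f β γ hb] at hzero
  unfold srcTerms at hm
  split at hm
  · rename_i t₁ t₂ heq
    rw [heq] at hzero
    simp only [List.map_cons, List.map_nil, List.sum_cons, List.sum_nil, add_zero] at hzero
    rw [Bool.or_eq_true] at hm
    rcases hm with h1 | h2
    · exact coord_eq_of_pairCoreB f β hβ h1 hzero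
    · exact coord_eq_of_pairCoreB f β hβ h2 (by rw [add_comm]; exact hzero)
  · exact absurd hm Bool.false_ne_true

omit [DecidableEq k] [DecidableEq K] in
/-- with the tie, a point vanishing off `{i, i'}` is the PAIR point of its `i'`-coordinate. OURS. [folklore] -/
theorem eq_pairpt {i i' : Fin 4} (hii' : i ≠ i') {ρ : k} {d : ℕ} {b : Fin 4 → K}
    (hb : ∀ m : Fin 4, m ∉ ({i, i'} : Finset (Fin 4)) → b m = 0) (htie : b i = f ρ * b i' ^ d) :
    b = Pi.single i' (b i') + Pi.single i (f ρ * b i' ^ d) := by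
  funext m
  rw [Pi.add_apply]
  by_cases hm : m = i'
  · subst hm; rw [Pi.single_eq_same, Pi.single_eq_of_ne (Ne.symm hii'), add_zero]
  · rw [Pi.single_eq_of_ne hm, zero_add]
    by_cases hmi : m = i
    · subst hmi; rw [Pi.single_eq_same]; exact htie
    · rw [Pi.single_eq_of_ne hmi]; exact hb m (by simp [hm, hmi])

end ParamLift

end Summit.ResolutionOfSingularities.ResolutionOfSingularities.Theorems.PIDim4

end
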